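import Summits.BirchSwinnertonDyer.BirchSwinnertonDyer.Theorems.ManinLocalTwoThreeEulerRemaindersForty
import Summits.BirchSwinnertonDyer.BirchSwinnertonDyer.Theorems.ManinLocalTwoThreeNewformFortyEight
import Summits.BirchSwinnertonDyer.BirchSwinnertonDyer.Theorems.ManinLocalTwoThreeEtaQuotientLowerUnipotent
import Summits.BirchSwinnertonDyer.BirchSwinnertonDyer.Theorems.ManinLocalTwoThreeLevelTwenty
import HarnessLib

/-!
# Level 40 (`2³·5`, genus `g(X₀(40)) = 3`), newform part 1: `φ₄₀ = η₂⁵η₅²η₂₀/(η₁²η₄η₁₀) − 2η₄²η₂₀²` is killed by the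
# trace to level `20`, and `φ₄₀ = q + 0·q² + O(q³)` — FACT-FREE

Cell bsd-f2-manin, route `ManinLocalTwoThree` (crux C2 `ManinOddAtFour`, stmt-22967: `2² ∣ 40`), prover seat p2 gen 27; the
level-`40` analogue of p2 g26's `…NewformFortyEight` / p3 g23's `…NewformSixtyFour`.  `S₂(Γ₀(40)) = ℂf₂₀ ⊕ ℂf₂₀(2τ) ⊕ ℂφ₄₀`
(`f₂₀ = η₂²η₁₀²`), and the newform `φ₄₀` (Cremona `40a1`, `aₙ = 1, 0, 0, 0, 1, 0, −4, 0, −3, …`) has to be separated from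
the old forms.  NEW DEVICE: `φ₄₀` is NOT an `η`-quotient, but it is the difference of two `η`-quotient cusp forms SUPPORTED ON
THE DIVISORS OF `20` (found by an exhaustive search over Newman–Ligozat exponent vectors, seat folder `scripts/search40b.py`):

  `φ₄₀ = g₁ − 2g₂`,  `g₁ = η(2τ)⁵η(5τ)²η(20τ)/(η(τ)²η(4τ)η(10τ)) = q + 2q² + q⁵ − ⋯`,  `g₂ = η(4τ)²η(20τ)² = f₂₀(2τ) = q² − 2q⁶ − ⋯`,

so that Dedekind's functional equation under the lower unipotent `W = (1 0; 20 1)` applies factor by factor.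

* §1 `g₁, g₂ ∈ S₂(Γ₀(40))` (Ligozat certificates); `φ₄₀ := g₁ − 2g₂` is a cusp form (carried as `φ` with
  `⇑φ = g₁ − 2g₂`, no definition).
* §2 `q`-asymptotics: `g₁ = q + 2q² + o(q²)` (Euler functions and the remainder calculus, one inversion),
  `g₂ = q² + o(q²)`; hence — by a general coefficient-extraction lemma `cuspCoeff_eq_of_tendsto_sq` (`a₁, a₂` from a
  two-term asymptotic expansion) — `a₁(φ₄₀) = 1`, `a₂(φ₄₀) = 0`, `a₁(g₂) = 0`, `a₂(g₂) = 1`; `φ₄₀/q → 1` (so `φ₄₀ ≠ 0`).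
* (sequel `…NewformFortyTrace`, §3) the `W = (1 0; 20 1)`-law `g_i(Wτ) = −(20τ+1)²g_i(τ)` factor by factor, so the trace
  `S₂(Γ₀(40)) → S₂(Γ₀(20))` kills `g₁`, `g₂` and `φ₄₀`.

The sequel `…NewformPinningForty` concludes WITHOUT any `U₂`-computation: `ker(trace) = ℂg₁ ⊕ ℂg₂ ⊇ S₂(Γ₀(40))^{new}`, and
`a₁ = 1`, `a₂ = 0` (`4 ∣ 40`) pin `D.f = φ₄₀` for every `X₀(40)`-datum.  No definition, no named fact, no sorry.  Nothing here
proves C2, Manin's conjecture or BSD. [cite: Ligozat1975, Ch. 3] [cite: AtkinLehner1970, Lemma 7, Thm. 5]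
[cite: DiamondShurman2005, §5.1] [cite: Apostol1990, Thm. 3.4] [cite: CremonaAlgorithms1997, Table 3 (N = 40)]
-/

set_option autoImplicit false
-- lint-debt: the directory name repeats the summit name (sibling precedent `ManinLocalTwoThreeNewformFortyEight.lean`)
set_option linter.dupNamespace false

noncomputable section

open Complex Filter Topology Set Function Asymptotics Polynomial
open UpperHalfPlane hiding I
open scoped Real Topology Manifold MatrixGroups ModularForm
open ModularForm CongruenceSubgroup Matrix.SpecialLinearGroup
open Literature.NumberTheory.ModularForms
open Literature.NumberTheory.EllipticCurves Literature.NumberTheory.EllipticCurves.ModularForms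

namespace Summit.BirchSwinnertonDyer.BirchSwinnertonDyer.Theorems.ManinLocalTwoThree.NewformForty

open CuspToolkit QRemainder EulerRemainders EulerRemaindersForty
open NewformFortyEight (slash_mapGL)
open EtaQuotientLowerUnipotent (etaQuotient_smul_lowerUnipotent_of_mod)

/-! ## §1 `g₁ = η₂⁵η₅²η₂₀/(η₁²η₄η₁₀)`, `g₂ = η₄²η₂₀²` are cusp forms on `Γ₀(40)`; `φ₄₀ = g₁ − 2g₂` -/

/-- Ligozat/Newman certificate of `g₁` (`Σδr = Σ(40/δ)r = 24`, `∏δ^{|r|} = 800²`, orders `1,12,8,15,8,20,40,40 > 0` at the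
`8` cusps). [cite: Ligozat1975, Ch. 3] -/
theorem etaCert_g1 : EtaCert 40 [(1, -2), (2, 5), (4, -1), (5, 2), (10, -1), (20, 1)] 800 := by
  decide

/-- Ligozat/Newman certificate of `g₂ = η₄²η₂₀²` (`Σδr = 48`, `Σ(40/δ)r = 24`, `∏δ^{|r|} = 80²`). [cite: Ligozat1975, Ch. 3] -/
theorem etaCert_g2 : EtaCert 40 [(4, 2), (20, 2)] 80 := by
  decide

/-- **`g₁ ∈ S₂(Γ₀(40))`** (as a term: `etaQuotientCuspForm`). [cite: Ligozat1975, Ch. 3] -/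
theorem exists_cuspForm_g1 :
    ∃ G : CuspForm (Gamma0 40) 2, ⇑G = etaQuotient 40 (expFn [(1, -2), (2, 5), (4, -1), (5, 2), (10, -1), (20, 1)]) :=
  ⟨etaQuotientCuspForm 40 _ 2 (by decide) (newmanCond_of_etaCert etaCert_g1) etaCert_g1.2.2.2.2, rfl⟩

/-- **`g₂ ∈ S₂(Γ₀(40))`** (as a term: `etaQuotientCuspForm`). [cite: Ligozat1975, Ch. 3] -/
theorem exists_cuspForm_g2 : ∃ G : CuspForm (Gamma0 40) 2, ⇑G = etaQuotient 40 (expFn [(4, 2), (20, 2)]) :=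
  ⟨etaQuotientCuspForm 40 _ 2 (by decide) (newmanCond_of_etaCert etaCert_g2) etaCert_g2.2.2.2.2, rfl⟩

/-- **`φ₄₀ = g₁ − 2g₂ ∈ S₂(Γ₀(40))`** (a difference of two `η`-quotient cusp forms; no definition is introduced).
[cite: CremonaAlgorithms1997, Table 3 (N = 40)] -/
theorem exists_cuspForm_phi40 :
    ∃ φ : CuspForm (Gamma0 40) 2, ⇑φ = fun τ ↦ etaQuotient 40 (expFn [(1, -2), (2, 5), (4, -1), (5, 2), (10, -1), (20, 1)]) τ
      - 2 * etaQuotient 40 (expFn [(4, 2), (20, 2)]) τ := by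
  obtain ⟨G₁, h₁⟩ := exists_cuspForm_g1
  obtain ⟨G₂, h₂⟩ := exists_cuspForm_g2
  refine ⟨G₁ - (2 : ℂ) • G₂, funext fun τ ↦ ?_⟩
  rw [CuspForm.sub_apply, CuspForm.IsGLPos.smul_apply, smul_eq_mul, h₁, h₂]

/-! ## §2 `q`-asymptotics: `g₁ = q + 2q² + o(q²)`, `g₂ = q² + o(q²)`, and the first two coefficients -/

/-- **Coefficient extraction from a two-term expansion**: if `S ∈ S₂(Γ₀(N))` satisfies `S = aq + bq² + o(q²)` at `i∞`,
then `a₁(S) = a` and `a₂(S) = b` (the `q`-expansion of `S` sums to `S`, and a non-zero polynomial of degree `≤ 2` is not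
`o(q²)`). [cite: DiamondShurman2005, §1.1] -/
theorem cuspCoeff_eq_of_tendsto_sq {N : ℕ} (S : CuspForm (Gamma0 N) 2) {a b : ℂ}
    (h : Tendsto (fun τ : ℍ ↦ (S τ - (C a * X + C b * X ^ 2 : ℂ[X]).eval (Function.Periodic.qParam 1 (τ : ℂ)))
      / Function.Periodic.qParam 1 (τ : ℂ) ^ 2) atImInfty (𝓝 0)) :
    cuspCoeff S 1 = a ∧ cuspCoeff S 2 = b := by
  have hΓ := one_mem_strictPeriods_coe_gamma0 N
  have hper : Function.Periodic (⇑S ∘ ofComplex) 1 := SlashInvariantFormClass.periodic_comp_ofComplex S hΓ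
  have hmd : MDifferentiable 𝓘(ℂ) 𝓘(ℂ) ⇑S := CuspFormClass.holo S
  haveI : Fact (IsCusp OnePoint.infty ((Gamma0 N : Subgroup SL(2, ℤ)) : Subgroup (GL (Fin 2) ℝ))) :=
    ⟨Subgroup.isCusp_of_mem_strictPeriods one_pos hΓ⟩
  have hbd : IsBoundedAtImInfty ⇑S := ModularFormClass.bdd_at_infty S
  have hsum : ∀ τ : ℍ, HasSum (fun n : ℕ ↦ cuspCoeff S n • Function.Periodic.qParam 1 (τ : ℂ) ^ n) (S τ) :=
    fun τ ↦ hasSum_qExpansion one_pos hper hmd hbd τ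
  have h2 := tendsto_of_hasSum hper hmd hbd hsum 2
  -- the difference of the two polynomial approximations is `o(q²)`
  have hD := h.sub h2
  rw [sub_zero] at hD
  have hD' : Tendsto (fun τ : ℍ ↦ (cuspCoeff S 0 + (cuspCoeff S 1 - a) * Function.Periodic.qParam 1 (τ : ℂ)
      + (cuspCoeff S 2 - b) * Function.Periodic.qParam 1 (τ : ℂ) ^ 2) / Function.Periodic.qParam 1 (τ : ℂ) ^ 2)
      atImInfty (𝓝 0) := by
    refine hD.congr fun τ ↦ ?_
    simp only [Finset.sum_range_succ, Finset.sum_range_zero, eval_add, eval_mul, eval_C, eval_pow, eval_X, zero_add]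
    ring
  have hq := QRemainder.tendsto_qParam
  -- (i) the constant coefficient vanishes
  have h0 : cuspCoeff S 0 = 0 := by
    have hA := hD'.mul (hq.pow 2)
    rw [zero_mul] at hA
    have hB : Tendsto (fun τ : ℍ ↦ cuspCoeff S 0 + (cuspCoeff S 1 - a) * Function.Periodic.qParam 1 (τ : ℂ)
        + (cuspCoeff S 2 - b) * Function.Periodic.qParam 1 (τ : ℂ) ^ 2) atImInfty (𝓝 (cuspCoeff S 0)) := by
      have := ((tendsto_const_nhds (x := cuspCoeff S 0)).add (hq.const_mul (cuspCoeff S 1 - a))).add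
        ((hq.pow 2).const_mul (cuspCoeff S 2 - b))
      rw [mul_zero, add_zero, zero_pow two_ne_zero, mul_zero, add_zero] at this
      exact this
    have hA' : Tendsto (fun τ : ℍ ↦ cuspCoeff S 0 + (cuspCoeff S 1 - a) * Function.Periodic.qParam 1 (τ : ℂ)
        + (cuspCoeff S 2 - b) * Function.Periodic.qParam 1 (τ : ℂ) ^ 2) atImInfty (𝓝 0) := by
      refine hA.congr fun τ ↦ ?_
      exact div_mul_cancel₀ _ (pow_ne_zero _ (qParam_ne_zero τ))
    exact tendsto_nhds_unique hB hA'
  -- (ii) the first coefficient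
  have h1 : cuspCoeff S 1 = a := by
    have hA := hD'.mul hq
    rw [zero_mul] at hA
    have hA' : Tendsto (fun τ : ℍ ↦ (cuspCoeff S 1 - a) + (cuspCoeff S 2 - b) * Function.Periodic.qParam 1 (τ : ℂ))
        atImInfty (𝓝 0) := by
      refine hA.congr fun τ ↦ ?_
      have hqτ := qParam_ne_zero τ
      rw [h0]
      field_simp
      ring
    have hB : Tendsto (fun τ : ℍ ↦ (cuspCoeff S 1 - a) + (cuspCoeff S 2 - b) * Function.Periodic.qParam 1 (τ : ℂ))
        atImInfty (𝓝 (cuspCoeff S 1 - a)) := by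
      have := (tendsto_const_nhds (x := cuspCoeff S 1 - a)).add (hq.const_mul (cuspCoeff S 2 - b))
      rw [mul_zero, add_zero] at this
      exact this
    exact sub_eq_zero.mp (tendsto_nhds_unique hB hA')
  -- (iii) the second coefficient
  have h2' : cuspCoeff S 2 = b := by
    have hA' : Tendsto (fun _ : ℍ ↦ cuspCoeff S 2 - b) atImInfty (𝓝 0) := by
      refine hD'.congr fun τ ↦ ?_
      have hqτ := qParam_ne_zero τ
      rw [h0, h1]
      field_simp
      ring
    exact sub_eq_zero.mp (tendsto_nhds_unique tendsto_const_nhds hA')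
  exact ⟨h1, h2'⟩

/-- **`g₁ = q + 2q² + o(q²)`** (`g₁/q = E₂⁵E₅²E₂₀/(E₁²E₄E₁₀)`, `E₁²E₄E₁₀ = 1 − 2q − q² + o(q²)`, inverse `1 + 2q + 5q²`).
[folklore] -/
theorem tendsto_g1_sub :
    Tendsto (fun τ : ℍ ↦ (etaQuotient 40 (expFn [(1, -2), (2, 5), (4, -1), (5, 2), (10, -1), (20, 1)]) τ
      - (C 1 * X + C 2 * X ^ 2 : ℂ[X]).eval (Function.Periodic.qParam 1 (τ : ℂ)))
      / Function.Periodic.qParam 1 (τ : ℂ) ^ 2) atImInfty (𝓝 0) := by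
  have hE1 := EulerRemaindersTwenty.tendsto_mono (show 2 ≤ 9 by norm_num) tendsto_eulerFn_one_nine
  have hE2 := EulerRemaindersTwenty.tendsto_mono (show 2 ≤ 9 by norm_num) EulerRemaindersFortyEight.tendsto_eulerFn_two_nine
  have hE4 := tendsto_eulerFn (δ := 4) (m := 2) (by norm_num)
  have hE5 := tendsto_eulerFn (δ := 5) (m := 2) (by norm_num)
  have hE10 := tendsto_eulerFn (δ := 10) (m := 2) (by norm_num)
  have hE20 := tendsto_eulerFn (δ := 20) (m := 2) (by norm_num)
  -- denominator `E₁²E₄E₁₀ = 1 − 2q − q² + o(q²)` and its inverse `1 + 2q + 5q² + o(q²)`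
  have hden := QRemainder.reduce (1 - 2 * X - X ^ 2)
    (2 + X + 2 * X ^ 2 - 2 * X ^ 3 - 2 * X ^ 5 - 2 * X ^ 6 + X ^ 7 + 2 * X ^ 9 + X ^ 11)
    (by ring) (QRemainder.mul (QRemainder.mul (QRemainder.pow hE1 2) hE4) hE10)
  have hinv := QRemainder.inv (1 + 2 * X + 5 * X ^ 2) (-12 - 5 * X) (by ring)
    (fun τ ↦ mul_ne_zero (mul_ne_zero (pow_ne_zero _ (eulerFn_ne_zero (by norm_num) τ)) (eulerFn_ne_zero (by norm_num) τ))
      (eulerFn_ne_zero (by norm_num) τ)) (by simp) hden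
  -- numerator `qE₂⁵E₅²E₂₀ = q + o(q²)`
  have hnum := QRemainder.qParam_pow_mul 1 (QRemainder.mul (QRemainder.mul (QRemainder.pow hE2 5) (QRemainder.pow hE5 2)) hE20)
  have hG := QRemainder.reduce (C 1 * X + C 2 * X ^ 2)
    (-10 * X - 20 * X ^ 2 + 10 * X ^ 3 + 35 * X ^ 4 + 20 * X ^ 5 + 35 * X ^ 6 - 30 * X ^ 7 - 86 * X ^ 8 - 22 * X ^ 9
      - 40 * X ^ 10 + 30 * X ^ 11 + 85 * X ^ 12 + 20 * X ^ 13 + 45 * X ^ 14 - 10 * X ^ 15 - 30 * X ^ 16 - 10 * X ^ 17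
      - 26 * X ^ 18 - 2 * X ^ 19 - 5 * X ^ 20)
    (by simp only [map_ofNat, map_one]; ring) (QRemainder.mul hnum hinv)
  refine hG.congr fun τ ↦ ?_
  rw [g1_eq]
  ring

/-- **`g₂ = q² + o(q²)`.** [folklore] -/
theorem tendsto_g2_sub :
    Tendsto (fun τ : ℍ ↦ (etaQuotient 40 (expFn [(4, 2), (20, 2)]) τ
      - (C 0 * X + C 1 * X ^ 2 : ℂ[X]).eval (Function.Periodic.qParam 1 (τ : ℂ)))
      / Function.Periodic.qParam 1 (τ : ℂ) ^ 2) atImInfty (𝓝 0) := by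
  have hE4 := tendsto_eulerFn (δ := 4) (m := 2) (by norm_num)
  have hE20 := tendsto_eulerFn (δ := 20) (m := 2) (by norm_num)
  have hG := QRemainder.congr_poly (P' := C 0 * X + C 1 * X ^ 2) (by simp only [map_zero, map_one]; ring)
    (QRemainder.qParam_pow_mul 2 (QRemainder.mul (QRemainder.pow hE4 2) (QRemainder.pow hE20 2)))
  refine hG.congr fun τ ↦ ?_
  rw [g2_eq, mul_assoc]

/-- `g₂/q² → 1` at `i∞`. [folklore] -/
theorem tendsto_g2_div_qParam_sq :
    Tendsto (fun τ : ℍ ↦ etaQuotient 40 (expFn [(4, 2), (20, 2)]) τ / Function.Periodic.qParam 1 (τ : ℂ) ^ (2 : ℤ))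
      atImInfty (𝓝 1) :=
  tendsto_etaQuotient_div_qParam_zpow 40 (expFn [(4, 2), (20, 2)]) 2 (by decide)

/-- `g₁/q → 1` at `i∞`. [folklore] -/
theorem tendsto_g1_div_qParam :
    Tendsto (fun τ : ℍ ↦ etaQuotient 40 (expFn [(1, -2), (2, 5), (4, -1), (5, 2), (10, -1), (20, 1)]) τ
      / Function.Periodic.qParam 1 (τ : ℂ)) atImInfty (𝓝 1) := by
  have h := tendsto_etaQuotient_div_qParam_zpow 40 (expFn [(1, -2), (2, 5), (4, -1), (5, 2), (10, -1), (20, 1)]) 1 (by decide)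
  simpa only [zpow_one] using h

section Phi

variable (φ : CuspForm (Gamma0 40) 2)
  (hφ : ⇑φ = fun τ ↦ etaQuotient 40 (expFn [(1, -2), (2, 5), (4, -1), (5, 2), (10, -1), (20, 1)]) τ
      - 2 * etaQuotient 40 (expFn [(4, 2), (20, 2)]) τ)
include hφ

/-- **`φ₄₀ = q + 0·q² + o(q²)`.** [cite: CremonaAlgorithms1997, Table 3 (N = 40)] -/
theorem tendsto_phi40_sub :
    Tendsto (fun τ : ℍ ↦ (φ τ - (C 1 * X + C 0 * X ^ 2 : ℂ[X]).eval (Function.Periodic.qParam 1 (τ : ℂ)))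
      / Function.Periodic.qParam 1 (τ : ℂ) ^ 2) atImInfty (𝓝 0) := by
  have h := QRemainder.congr_poly (P' := C 1 * X + C 0 * X ^ 2) (by simp only [map_zero, map_one, map_ofNat]; ring)
    (QRemainder.sub tendsto_g1_sub (QRemainder.const_mul 2 tendsto_g2_sub))
  refine h.congr fun τ ↦ ?_
  rw [hφ]

/-- **`a₁(φ₄₀) = 1` and `a₂(φ₄₀) = 0`.** [cite: CremonaAlgorithms1997, Table 3 (N = 40)] -/
theorem cuspCoeff_phi40 : cuspCoeff φ 1 = 1 ∧ cuspCoeff φ 2 = 0 :=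
  cuspCoeff_eq_of_tendsto_sq φ (tendsto_phi40_sub φ hφ)

/-- `φ₄₀/q → 1` at `i∞`. [folklore] -/
theorem tendsto_phi40_div_qParam : Tendsto (fun τ : ℍ ↦ φ τ / Function.Periodic.qParam 1 (τ : ℂ)) atImInfty (𝓝 1) := by
  have hq : Tendsto (fun τ : ℍ ↦ Function.Periodic.qParam 1 (τ : ℂ)) atImInfty (𝓝 0) := QRemainder.tendsto_qParam
  have h := tendsto_g1_div_qParam.sub ((tendsto_g2_div_qParam_sq.mul hq).const_mul 2)
  rw [one_mul, mul_zero, sub_zero] at h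
  refine h.congr fun τ ↦ ?_
  have hqτ := qParam_ne_zero τ
  rw [hφ]
  field_simp

end Phi

/-- **`a₁(g₂) = 0` and `a₂(g₂) = 1`** for any cusp form with function `η₄²η₂₀²`. [folklore] -/
theorem cuspCoeff_g2 (G : CuspForm (Gamma0 40) 2) (hG : ⇑G = etaQuotient 40 (expFn [(4, 2), (20, 2)])) :
    cuspCoeff G 1 = 0 ∧ cuspCoeff G 2 = 1 :=
  cuspCoeff_eq_of_tendsto_sq G (by simpa only [hG] using tendsto_g2_sub)

end Summit.BirchSwinnertonDyer.BirchSwinnertonDyer.Theorems.ManinLocalTwoThree.NewformForty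

end
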